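import Summits.QuantumAdvantage.QuantumAdvantage.Theorems.WhiteBoxWalkWbwObfuscatedGluedTreesClear
import Summits.QuantumAdvantage.QuantumAdvantage.Theorems.WbwObfuscatedGluedTreesKowClearEvaluator
import Summits.QuantumAdvantage.QuantumAdvantage.Theorems.WbwObfuscatedGluedTreesKowClearDepthTrap
import Summits.QuantumAdvantage.QuantumAdvantage.Theorems.WbwObfuscatedGluedTreesKowClearSchedules
import Summits.QuantumAdvantage.QuantumAdvantage.Theorems.WbwObfuscatedGluedTreesKowClearHardwire
import Summits.QuantumAdvantage.QuantumAdvantage.Theorems.WbwObfuscatedGluedTreesKowClearPresentation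
import Summits.QuantumAdvantage.QuantumAdvantage.Theorems.WbwObfuscatedGluedTreesKowNbrSivEnc
import Summits.QuantumAdvantage.QuantumAdvantage.Theorems.WbwObfuscatedGluedTreesKowNbrUnname
import Summits.QuantumAdvantage.QuantumAdvantage.Theorems.WbwObfuscatedGluedTreesKowNbrPrpSymm
import Summits.QuantumAdvantage.QuantumAdvantage.Theorems.WbwObfuscatedGluedTreesKowNbrLabels
import Summits.QuantumAdvantage.QuantumAdvantage.Theorems.WbwObfuscatedGluedTreesKowNbrSort
import Summits.QuantumAdvantage.QuantumAdvantage.Theorems.WbwObfuscatedGluedTreesKowNbrBitFP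
import Summits.QuantumAdvantage.QuantumAdvantage.Theorems.WbwObfuscatedGluedTreesKowNbrOracle
import Summits.QuantumAdvantage.QuantumAdvantage.Theorems.WbwObfuscatedGluedTreesKowSupport

/-!
# Line `knowledge-of-walk-split`, STAGE 3 — CLOSED composition: the knowledge-free residual `ClearHardness`, pinned
# from below, and the NON-VACUITY of the admissibility antecedent (crux `WbwObfuscatedGluedTrees`,
# stmt-QuantumAdvantage-2340, route WhiteBoxWalk)

Lead prover-line-stmt-QuantumAdvantage-2340-c2-0 (2026-08-17), continuing the line of leads -0 / -1 (stages 1–2 CLOSED: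
`knowledgeTransfer_holds` p92709, `generatorTransfer_holds` / `typedCrux_holds` p100064).

## What stage 3 proves (`clearReduction_holds : ClearReduction`, all sixteen registered stubs LANDED)

1. `TypedCruxClear` (file `WhiteBoxWalkWbwObfuscatedGluedTreesClear`, p134440): the typed crux with the KNOWLEDGE-FREE antecedent
   `ClearHardness D O P` (SOME admissible reference presentation of the neighbour circuits has clause (C) IN THE CLEAR) —
   stages 1–2 used KWA₀/WordHard₀ only through the split; `ReferenceHardness → ClearHardness`, `TypedCruxClear → TypedCrux`.
2. LOWER PIN: clause (C) in the clear ⇒ `WordHard₀` for that presentation (`clauseC_imp_wordHard` fed by the polynomial-time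
   evaluator of the evaluating walk model, `stub_walkEvaluator`, p135181).
3. TYPED TRAP: bounded depth along the key schedule ⇒ `¬ ClearHardness` (brute-force walker, `stub_depthTrap`, p135395) — the
   residual item the planner files must carry depth growth.
4. NON-VACUITY: for EVERY efficient obfuscator `O` and EVERY efficient PRF scheme `P`, some master datum is `GenAdmissible` for
   `(O, P)` (and `RefAdmissible` for its own presentation) with depth `→ ∞` — `stub_presentation` (p135734 + p136110: the language
   of the neighbour predicate is in `P`, `P ⊆ P/poly`, hard-wire the key prefix `stub_hardwire`/`stub_codeLength` p135011, schedules
   `stub_schedules` p135078) — made UNCONDITIONAL here by `nbrBitFP_of_isEfficient`, which assembles `NbrBitFP P` (the neighbour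
   predicate is polynomial-time ON CODES) from the wave-2 toolkit: SIV naming/un-naming (p136359, p136649), the keyed Feistel
   permutation and its inverse (p136466, p136817), neighbour labels (p136765), sorting (p136453), the oracle (p136894), the
   assembly (p136457).  So the antecedent class of `TypedCruxClear` is INHABITED at every BPR15 §5.1 parameter point
   (`typedCruxClear_antecedent_inhabited`): the typing proposed to the planner is not vacuous.

## What remains of the crux (honest scope, unchanged)

`ClearHardness` itself — does ANY equal-size presentation of `N_K` hide the EXIT from classical white-box walkers? — is the
crux's open core (crux-grade; Aaronson arXiv:2209.06930 p.9 records the instantiation as open), never asserted here; with it,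
`FPData` (a P-UNIFORM circuit presentation: needs a P-uniform classical TM→circuit compiler the tree lacks) and clause (Q)
(`WbwSuccinctWalk`), `ResidualConjectureClear` gives `WbwEngine` (`wbwEngine_of_residualConjectureClear`).

## Disproof.lean (cycles 1–4) honoured

No `_false_without_` theorem exists.  §5 (`no_erasing_terminal`): nothing here claims an answer-free terminal world.  §6/§7: the
admissibility predicates are stage 2's verbatim; conjunct 4 is exactly the non-vacuity check §6 (T-b) showed an earlier predicate FAILED.
-/

set_option linter.dupNamespace false

namespace Summit.QuantumAdvantage.QuantumAdvantage.Cruxes.WbwObfuscatedGluedTrees.KnowledgeOfWalkSplit.Generator.Clear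

open Literature.Computability.Cryptography Literature.Computability.Complexity Filter Asymptotics
open Literature.Computability.Cryptography.ObfuscatedGluedTrees
open Literature.Computability.QuantumComplexity
open Literature.Computability.Complexity.CodeFP (natE unE bitE pairE strE rawE)
open Summit.QuantumAdvantage.QuantumAdvantage.Theorems.WbwObfuscatedGluedTrees.Negative (ClauseC)
open Summit.QuantumAdvantage.QuantumAdvantage.Theorems.WbwObfuscatedGluedTrees.KnowledgeOfWalk (WordHard)
open Summit.QuantumAdvantage.QuantumAdvantage.Theorems.WbwObfuscatedGluedTrees.KnowledgeOfWalk.Generator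

/-! ## §1 The registered stubs of the composition, by name (all LANDED; `stub_clearTransfer` is
`KnowledgeOfWalkSplit.Generator.stub_clearTransfer`, the others are the Theorems-side declarations of the same names) -/

namespace Registered

/-- Statement of `stub_clearTransfer`. -/
abbrev stub_clearTransfer : Prop := KnowledgeOfWalkSplit.Generator.ClearTransfer
/-- Statement of `stub_walkEvaluator` (landed p135181, `WbwObfuscatedGluedTreesKowClearEvaluator`). -/
abbrev stub_walkEvaluator : Prop :=
  ∃ ev : List Bool → List Bool, PolyTimeComputable (id : List Bool → List Bool) (id : List Bool → List Bool) ev ∧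
    ∀ (u e : List Bool) (C : SizedCircuit) (w : List ℕ),
      ev (boolPair (boolPair u (boolPair (encodeSizedCircuit C) e)) (encodingListNatBool.encode w)) =
        (evalModel.endpoint (boolPair (encodeSizedCircuit C) e) w).getD []
/-- Statement of `stub_depthTrap` (landed p135395, `WbwObfuscatedGluedTreesKowClearDepthTrap`). -/
abbrev stub_depthTrap : Prop :=
  ∀ (D : MasterData) (Γ₁ : D.Presentation) (O : CircuitObfuscator) (P : PuncturablePRFScheme),
    GenAdmissible D O P → RefAdmissible D Γ₁ O →
    (∃ B : ℕ, ∀ n : ℕ, D.δ (D.t n) ≤ B) → stub_walkEvaluator →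
    ¬ ClauseC (D.lineData Γ₁ P).gen₀ (D.lineData Γ₁ P).answer
/-- Statement of `stub_schedules` (landed p135078, `WbwObfuscatedGluedTreesKowClearSchedules`). -/
abbrev stub_schedules : Prop := Presentation.SchedHyp
/-- Statement of `stub_hardwire` (landed p135011, `WbwObfuscatedGluedTreesKowClearHardwire`). -/
abbrev stub_hardwire : Prop := Presentation.HardwireHyp
/-- Statement of `stub_codeLength` (landed p135011, same file). -/
abbrev stub_codeLength : Prop := Presentation.CodeLenHyp
/-- Statement of `stub_presentation` (landed p136110, `WbwObfuscatedGluedTreesKowClearPresentation`). -/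
abbrev stub_presentation : Prop :=
  ∀ (O : CircuitObfuscator) (P : PuncturablePRFScheme), O.IsEfficient → Presentation.NbrHyp P →
    stub_schedules → stub_hardwire → stub_codeLength →
    ∃ D : MasterData, GenAdmissible D O P ∧ RefAdmissible D D.Γ O ∧
      ∀ B : ℕ, ∃ n₀ : ℕ, ∀ n, n₀ ≤ n → B ≤ D.δ (D.t n)

end Registered

/-- `NbrBitFP P` — the neighbour predicate is polynomial-time ON CODES (`Presentation.NbrHyp`, re-exported at crux level). -/
abbrev NbrBitFP (P : PuncturablePRFScheme) : Prop := Presentation.NbrHyp P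

/-! ## §2 The stage-3 target and its composition BY NAME -/

/-- **Stage-3 target.** (1) the typed crux from the knowledge-free residual; (2) the residual implies white-box
path-finding hardness of its presentation; (3) it forces unbounded depth; (4) its admissibility antecedent is satisfiable
for every efficient obfuscator, modulo `NbrBitFP` (discharged in §3 for every efficient `P`). -/
def ClearReduction : Prop :=
  TypedCruxClear ∧
  (∀ (D : MasterData) (Γ₁ : D.Presentation) (O : CircuitObfuscator) (P : PuncturablePRFScheme),
      GenAdmissible D O P → RefAdmissible D Γ₁ O →
      ClauseC (D.lineData Γ₁ P).gen₀ (D.lineData Γ₁ P).answer →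
      WordHard evalModel (D.lineData Γ₁ P).gen₀ (D.lineData Γ₁ P).answer) ∧
  (∀ (D : MasterData) (O : CircuitObfuscator) (P : PuncturablePRFScheme),
      GenAdmissible D O P → (∃ B : ℕ, ∀ n : ℕ, D.δ (D.t n) ≤ B) → ¬ ClearHardness D O P) ∧
  (∀ (O : CircuitObfuscator) (P : PuncturablePRFScheme), O.IsEfficient → NbrBitFP P →
      ∃ D : MasterData, GenAdmissible D O P ∧ RefAdmissible D D.Γ O ∧
        ∀ B : ℕ, ∃ n₀ : ℕ, ∀ n, n₀ ≤ n → B ≤ D.δ (D.t n))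

/-- **Composition: the seven registered stubs give the stage-3 target BY NAME.** -/
theorem WbwObfuscatedGluedTrees_of (h₁ : Registered.stub_clearTransfer) (hA : Registered.stub_walkEvaluator)
    (hC : Registered.stub_depthTrap) (hE : Registered.stub_schedules) (hF : Registered.stub_hardwire)
    (hF' : Registered.stub_codeLength) (hG : Registered.stub_presentation) : ClearReduction := by
  refine ⟨?_, ?_, ?_, ?_⟩
  · -- (1) the typed crux from the knowledge-free residual
    refine typedCruxClear_of_generatorClearTransfer ?_
    intro D Γ₁ ε O P hε hO hadm href hC₀
    have hC' : ClauseC ((D.lineData Γ₁ P).gen O) (D.lineData Γ₁ P).answer :=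
      h₁ (D.lineData Γ₁ P) ε O hε hO (stub_admissible D Γ₁ O P hadm href) hC₀
    exact stub_transport _ _ _ _ (stub_factorisation D Γ₁ O P hadm) hC'
  · -- (2) lower pin: (C) in the clear ⇒ WordHard₀
    intro D Γ₁ O P hadm href hC₀
    obtain ⟨ev, hev, hspec⟩ := hA
    refine Summit.QuantumAdvantage.QuantumAdvantage.Theorems.WbwObfuscatedGluedTrees.KnowledgeOfWalk.clauseC_imp_wordHard
      evalModel _ _ ev hev (fun n s w => ?_) (stub_coherent D Γ₁ O P hadm href) hC₀
    exact hspec (Computability.unaryEncodeNat n) _ ⟨_, Γ₁ _ _⟩ w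
  · -- (3) typed trap
    intro D O P hadm hB ⟨Γ₁, href, hC₀⟩
    exact hC D Γ₁ O P hadm href hB hA hC₀
  · -- (4) non-vacuity modulo `NbrBitFP`
    intro O P hO hN
    exact hG O P hO hN hE hF hF'

/-- **The stage-3 target holds**: all seven registered stubs landed. -/
theorem clearReduction_holds : ClearReduction :=
  WbwObfuscatedGluedTrees_of KnowledgeOfWalkSplit.Generator.stub_clearTransfer stub_walkEvaluator stub_depthTrap
    stub_schedules stub_hardwire stub_codeLength stub_presentation

/-! ## §3 `NbrBitFP P` for every efficient scheme (wave-2 toolkit), and the unconditional non-vacuity -/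

/-- **The neighbour predicate is polynomial-time on codes** for every efficient PRF scheme: the PRF evaluation map on codes
(`codeFP_prfEval_of_isEfficient`) feeds SIV encryption / un-naming and the keyed Feistel permutation ± inverse, whence the
neighbour labels, the sorted oracle, and the bit `N_K(x)`. -/
theorem nbrBitFP_of_isEfficient {P : PuncturablePRFScheme} (hP : P.IsEfficient) : NbrBitFP P := by
  have h0 := Summit.QuantumAdvantage.QuantumAdvantage.Theorems.WhiteBoxWalk.codeFP_prfEval_of_isEfficient hP
  have h1 := toolkit_sivEnc P h0
  have h2 := toolkit_unname P h0
  have h3 := toolkit_prp P h0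
  have h4 := toolkit_prpSymm P h0
  have h5 := toolkit_nbrLabels P h0 h3 h4
  have h6 := toolkit_oracle P h0 h1 h2 h5 toolkit_sortNames
  exact toolkit_nbrBitFP P h6

/-- **Non-vacuity of the admissibility antecedent, unconditional in the primitives' efficiency**: for every efficient
obfuscator and every efficient puncturable-PRF scheme SOME master datum is `GenAdmissible` (and `RefAdmissible` for its own
presentation), with depth `→ ∞` along the key schedule. -/
theorem exists_genAdmissible {O : CircuitObfuscator} {P : PuncturablePRFScheme} (hO : O.IsEfficient) (hP : P.IsEfficient) :
    ∃ D : MasterData, GenAdmissible D O P ∧ RefAdmissible D D.Γ O ∧ ∀ B : ℕ, ∃ n₀ : ℕ, ∀ n, n₀ ≤ n → B ≤ D.δ (D.t n) :=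
  clearReduction_holds.2.2.2 O P hO (nbrBitFP_of_isEfficient hP)

/-- **The antecedent class of `TypedCruxClear` is inhabited at every BPR15 §5.1 parameter point**: for every sub-exp iO `O`
and every `(t,δ)`-secure puncturable PRF `P` there is a `GenAdmissible` master datum of unbounded depth (so the typing
`TypedCruxClear` proposed for the informal crux is not vacuous; what it leaves open is `ClearHardness` for such data). -/
theorem typedCruxClear_antecedent_inhabited {ε : ℝ} {O : CircuitObfuscator} (hO : IsSubexpIO ε ppolyCircuits O)
    {P : PuncturablePRFScheme} {t δ : ℕ → ℝ} (hP : IsTDSecurePuncturablePRF P t δ) :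
    ∃ D : MasterData, GenAdmissible D O P ∧ RefAdmissible D D.Γ O ∧ ∀ B : ℕ, ∃ n₀ : ℕ, ∀ n, n₀ ≤ n → B ≤ D.δ (D.t n) :=
  exists_genAdmissible hO.isEfficient hP.1.1

/-- **Depth growth is NECESSARY for the residual** (conjunct 3 by name): at a `GenAdmissible` datum of bounded depth,
`ClearHardness` fails — hence so does `ReferenceHardness` (`clearHardness_of_referenceHardness`). -/
theorem not_clearHardness_of_bounded_depth {D : MasterData} {O : CircuitObfuscator} {P : PuncturablePRFScheme}
    (hadm : GenAdmissible D O P) (hB : ∃ B : ℕ, ∀ n : ℕ, D.δ (D.t n) ≤ B) : ¬ ClearHardness D O P :=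
  clearReduction_holds.2.2.1 D O P hadm hB

/-- The same for the stage-2 residual `ReferenceHardness`. -/
theorem not_referenceHardness_of_bounded_depth {D : MasterData} {O : CircuitObfuscator} {P : PuncturablePRFScheme}
    (hadm : GenAdmissible D O P) (hB : ∃ B : ℕ, ∀ n : ℕ, D.δ (D.t n) ≤ B) : ¬ ReferenceHardness D O P :=
  fun h => not_clearHardness_of_bounded_depth hadm hB (clearHardness_of_referenceHardness hadm h)

/-- **The residual pins white-box path-finding hardness** (conjunct 2 by name): `ClearHardness D O P` yields an admissible
presentation whose clear reference generator is `WordHard` in the evaluating model. -/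
theorem exists_wordHard_of_clearHardness {D : MasterData} {O : CircuitObfuscator} {P : PuncturablePRFScheme}
    (hadm : GenAdmissible D O P) (h : ClearHardness D O P) :
    ∃ Γ₁ : D.Presentation, RefAdmissible D Γ₁ O ∧
      WordHard evalModel (D.lineData Γ₁ P).gen₀ (D.lineData Γ₁ P).answer := by
  obtain ⟨Γ₁, href, hC₀⟩ := h
  exact ⟨Γ₁, href, clearReduction_holds.2.1 D Γ₁ O P hadm href hC₀⟩

end Summit.QuantumAdvantage.QuantumAdvantage.Cruxes.WbwObfuscatedGluedTrees.KnowledgeOfWalkSplit.Generator.Clear
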